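import Literature.MathematicalPhysics.QuantumFieldTheory.Balaban1983to89.Node00.BetaOfRecord

/-!
# CRIT-1 CUT-1 kernel №2 for lens-2 «flow-gronwall-ttel» v2 (2026-08-30T17:02Z, `StepContraction118`) — the Grönwall glue survives the TWO print-faithful
# repairs CRIT-1 asks for: (F2a) a coupling-INDEPENDENT source `b₀` ((1.18)'s `E₀` is an absolute constant, [RG1] p.263; print recovers it by the small factor
# `O(1)α₂⁻¹ε₁`, p.280 — not by `g_k`), and (F2b) dependence of the new level on ALL previous levels (the step-(k+1) action carries `Σ_{j≤k} E^{(j)}`, (1.7) p.261),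
# not on level `k` alone.  Same fixed point `M = (b₀ + γb₁)/(1 − θ − γΛ)`; strong induction over the history.  Hypothesis shapes only; nothing of Bałaban asserted;
# K0⁷ NOT closed; the Yang–Mills mass gap (Clay) is NOT proved by any of this.

Cell `ym-nodeO-ideate`, CRITIC seat `ym-nodeO-crit-1` (refuter-ym-nodeO-crit-1-g31-0; count-neutral; crux WORKFILE on `stmt-QuantumFields-20541`, not a gate filing).
-/

noncomputable section

open Literature.MathematicalPhysics.QuantumFieldTheory.Balaban1983to89
open Literature.MathematicalPhysics.QuantumFieldTheory.Balaban1983to89.FlowStep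
open Literature.MathematicalPhysics.QuantumFieldTheory.Balaban1983to89.Node00

namespace Summit.QuantumFields.YangMills.Cruxes.Record13SepCoPHInhabited.Crit1Cut1Lens2Hist

/-- History-indexed size functional (lens-2's `HSize`; here read as «the (1.18)-constant of the level-k term for the history v», or any other level size). -/
abbrev HSize : Type := (k : ℕ) → (Fin (k + 1) → ℝ) → ℝ

/-- The history `v = (g_0, …, g_k)` truncated to its first `j + 1` couplings (`j ≤ k`). -/
def trunc {k : ℕ} (v : Fin (k + 1) → ℝ) (j : ℕ) (hj : j ≤ k) : Fin (j + 1) → ℝ :=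
  fun i => v (Fin.castLE (by omega) i)

theorem mem_box_iff {γ : ℝ} {k : ℕ} {v : Fin (k + 1) → ℝ} : v ∈ Box γ k ↔ ∀ i, 0 < v i ∧ v i ≤ γ := by
  simp [Box, Set.mem_Ioc]

theorem trunc_mem_box {γ : ℝ} {k : ℕ} {v : Fin (k + 1) → ℝ} (hv : v ∈ Box γ k) (j : ℕ) (hj : j ≤ k) : trunc v j hj ∈ Box γ j := by
  rw [mem_box_iff] at hv ⊢
  exact fun i => hv _

theorem box_mono {γ γ' : ℝ} (hγ : γ ≤ γ') {k : ℕ} {v : Fin (k + 1) → ℝ} (h : v ∈ Box γ k) : v ∈ Box γ' k := by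
  rw [mem_box_iff] at h ⊢
  exact fun i => ⟨(h i).1, (h i).2.trans hγ⟩

/-- **ONE STEP WITH FULL MEMORY AND A COUPLING-INDEPENDENT SOURCE (box histories only):** if every previous level `j ≤ k` of the history has size `≤ E`,
the new level has size `≤ θ·E + b₀ + g_{k+1}·(b₁ + Λ·E)`.  (lens-2 v2's `StepContraction118` is the special case «memory = last level, b₀ = 0».) [folklore] -/
def StepContractionHistOn (γbar : ℝ) (e : HSize) (θ b₀ b₁ Λ : ℝ) : Prop :=
  ∀ (k : ℕ) (v : Fin (k + 2) → ℝ) (E : ℝ), v ∈ Box γbar (k + 1) → 0 ≤ E →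
    (∀ (j : ℕ) (hj : j ≤ k), e j (trunc v j (by omega)) ≤ E) →
      e (k + 1) v ≤ θ * E + b₀ + v (Fin.last (k + 1)) * (b₁ + Λ * E)

/-- **Base with a coupling-independent part:** `e 0 (g_0) ≤ b₀ + g_0·b₁`. [folklore] -/
def BaseHistOn (γbar : ℝ) (e : HSize) (b₀ b₁ : ℝ) : Prop := ∀ v : Fin 1 → ℝ, v ∈ Box γbar 0 → e 0 v ≤ b₀ + v 0 * b₁

/-- The Grönwall level with the constant source: `M = (b₀ + γ b₁)/(1 − θ − γΛ)`. -/
def gronwallM₀ (θ b₀ b₁ Λ γ : ℝ) : ℝ := (b₀ + γ * b₁) / (1 - θ - γ * Λ)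

theorem gronwallM₀_nonneg {θ b₀ b₁ Λ γ : ℝ} (hb₀ : 0 ≤ b₀) (hb : 0 ≤ b₁) (hγ : 0 ≤ γ) (hgap : θ + γ * Λ < 1) : 0 ≤ gronwallM₀ θ b₀ b₁ Λ γ := by
  unfold gronwallM₀
  exact div_nonneg (by positivity) (by linarith)

theorem gronwallM₀_eq {θ b₀ b₁ Λ γ : ℝ} (hgap : θ + γ * Λ < 1) :
    θ * gronwallM₀ θ b₀ b₁ Λ γ + b₀ + γ * (b₁ + Λ * gronwallM₀ θ b₀ b₁ Λ γ) = gronwallM₀ θ b₀ b₁ Λ γ := by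
  unfold gronwallM₀
  have h : (1 - θ - γ * Λ) ≠ 0 := by intro h0; linarith
  field_simp
  ring

/-- **★ DISCRETE GRÖNWALL WITH FULL MEMORY AND CONSTANT SOURCE** (`γ ≤ γ̄`, `θ + γΛ < 1`): every level of every box history has size `≤ M = (b₀ + γb₁)/(1 − θ − γΛ)`.
Strong induction on the level.  So lens-2's glue survives BOTH print-faithful repairs (F2a: `b₀`; F2b: memory); the readout∕box step is unchanged (`β' = B + A·M + γ(a₀ + a₁M)`). [folklore] -/
theorem size_le_of_stepContractionHistOn {e : HSize} {θ b₀ b₁ Λ γ γbar : ℝ} (hθ : 0 ≤ θ) (hb₀ : 0 ≤ b₀) (hb : 0 ≤ b₁) (hΛ : 0 ≤ Λ) (hγ : 0 ≤ γ)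
    (hγbar : γ ≤ γbar) (hgap : θ + γ * Λ < 1) (hstep : StepContractionHistOn γbar e θ b₀ b₁ Λ) (hbase : BaseHistOn γbar e b₀ b₁) :
    ∀ (k : ℕ) (v : Fin (k + 1) → ℝ), v ∈ Box γ k → e k v ≤ gronwallM₀ θ b₀ b₁ Λ γ := by
  have hM := gronwallM₀_nonneg (θ := θ) (Λ := Λ) hb₀ hb hγ hgap
  set M := gronwallM₀ θ b₀ b₁ Λ γ with hMdef
  have hfix : θ * M + b₀ + γ * (b₁ + Λ * M) = M := gronwallM₀_eq hgap
  intro k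
  induction k using Nat.strong_induction_on with
  | _ k ih =>
    intro v hv
    cases k with
    | zero =>
      have h0 := (mem_box_iff.mp hv) 0
      calc e 0 v ≤ b₀ + v 0 * b₁ := hbase v (box_mono hγbar hv)
        _ ≤ b₀ + γ * b₁ := by nlinarith [h0.2, h0.1]
        _ ≤ θ * M + b₀ + γ * (b₁ + Λ * M) := by nlinarith [mul_nonneg hθ hM, mul_nonneg hγ (mul_nonneg hΛ hM)]
        _ = M := hfix
    | succ k =>
      have hlast := (mem_box_iff.mp hv) (Fin.last (k + 1))
      have hprev : ∀ (j : ℕ) (hj : j ≤ k), e j (trunc v j (by omega)) ≤ M :=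
        fun j hj => ih j (by omega) (trunc v j (by omega)) (trunc_mem_box hv j (by omega))
      have hsrc0 : 0 ≤ b₁ + Λ * M := by positivity
      calc e (k + 1) v ≤ θ * M + b₀ + v (Fin.last (k + 1)) * (b₁ + Λ * M) := hstep k v M (box_mono hγbar hv) hM hprev
        _ ≤ θ * M + b₀ + γ * (b₁ + Λ * M) := by
            have := mul_le_mul_of_nonneg_right hlast.2 hsrc0
            linarith
        _ = M := hfix

/-- lens-2 v2's last-level-only, `b₀ = 0` sentence (restated VERBATIM in shape over an abstract `HSize`) … -/
def StepContractionLastOn (γbar : ℝ) (e : HSize) (θ b₁ Λ : ℝ) : Prop :=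
  ∀ (k : ℕ) (v : Fin (k + 2) → ℝ) (E : ℝ), v ∈ Box γbar (k + 1) → 0 ≤ E → e k (Fin.init v) ≤ E →
    e (k + 1) v ≤ θ * E + v (Fin.last (k + 1)) * (b₁ + Λ * E)

theorem trunc_last_eq_init {k : ℕ} (v : Fin (k + 2) → ℝ) : trunc v k (by omega) = Fin.init v := by
  funext i
  simp [trunc, Fin.init, Fin.castLE, Fin.castSucc, Fin.castAdd]

/-- … IMPLIES the full-memory sentence with `b₀ = 0` (so the repair only WEAKENS what lens-2 must supply). [folklore] -/
theorem stepContractionHistOn_of_last {γbar : ℝ} {e : HSize} {θ b₁ Λ : ℝ} (h : StepContractionLastOn γbar e θ b₁ Λ) :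
    StepContractionHistOn γbar e θ 0 b₁ Λ := by
  intro k v E hv hE hprev
  have hk : e k (Fin.init v) ≤ E := by
    have := hprev k le_rfl
    rwa [trunc_last_eq_init] at this
  have := h k v E hv hE hk
  linarith

end Summit.QuantumFields.YangMills.Cruxes.Record13SepCoPHInhabited.Crit1Cut1Lens2Hist

end
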